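import Summits.QuantumFields.YangMills.Theorems.BalabanLadderIRTwistedSlabOneBox
import HarnessLib

/-!
# The plug for T1, CORRECTED: uniform vacuum dominance in EXPONENTIAL (free-energy) form ⇒ `TwistedSlabAnchor`

HELPER toward stub **T1** `TwistedSlabAnchor` (LINE `twisted-slab-continuity`, crux `IRcof` stmt-QuantumFields-26930, census row 43; LEAD prover
ym-ir-line-tsc-p1; `--supports` the crux, `--as helper`; part 3, sequel of `BalabanLadderIRTwistedSlabOneBox`).

WHY THIS FILE EXISTS (self-correction, same session).  `TwistedSlab.twistedSlabAnchor_of_uniform_vacuumDominance` (part 2, §3) is a TRUE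
implication whose hypothesis is TOO STRONG to be satisfiable uniformly in `L`: it asks `projSlabZ(t) ≤ λ^t·(1 + C·L·e^{−ct})` for every
`L ≥ 2` at fixed `t ≥ 2`, but `λ` is forced to be the top eigenvalue `λ₀` (take `t → ∞` in the two-sided sandwich) and
`log(projSlabZ(t)/λ₀^t) = log Σᵢ wᵢ (λᵢ/λ₀)^t` is the pressure of the `e₂ = 0` sector at temporal period `t` — EXTENSIVE in the long side
`L` (independent local excitations), so no `1 + C·L·e^{−ct}` bound holds at fixed `t` as `L → ∞`.  That plug is therefore vacuous (kept in
the tree for the record; nothing false was asserted).  The CORRECT uniform shape is the free-energy one a cluster expansion delivers: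

  `λ^t ≤ projSlabZ(t) ≤ λ^t · exp(C·L·e^{−ct})`   (`t ≥ 2`),

i.e. the finite-`t` correction to the `e₂ = 0` pressure of the twisted femto tube is exponentially small in `t` and at most linear in `L`
(one-particle states of a massive tube: `Σ_p e^{−ω(p)t} ≍ L·e^{−mt}`; multi-particle states exponentiate).  From it T1 follows with
constant `max (4C) (e^c)`: where `x := C·L·e^{−ct} ≤ 1`, `e^x − 1 ≤ 2x` and `defect ≤ 2·(e^x − 1) ≤ 4x`
(`defect_le_two_mul_of_sandwich`); where `x > 1`, `defect ≤ 1 < x ≤ 4x`.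

RESULTS: `defect_le_four_mul_of_exp_sandwich` (one box, one `t`: the two-sided
exponential sandwich with `0 ≤ x` and `defect ≤ 1` ⇒ `defect ≤ 4x`);
★ `twistedSlabAnchor_of_uniform_expVacuumDominance` — THE PLUG (corrected): the uniform exponential sandwich, in T1's binders, ⇒
`TwistedSlabAnchor` by `exact`.  The one-box theorem `projSlabZ_vacuumDominated_oneBox` (part 2) fits this shape too
(`1 + D·τ^M ≤ exp(D·τ^M)`), with box-dependent constants.

HONEST FRAMING: an implication and real arithmetic; its hypothesis — β- and L-UNIFORM exponential vacuum dominance of the `e₂ = 0` sector of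
the twisted femto tube — is the open content of T1 (weak-coupling cluster expansion about the isolated twist-eating vacuum; not in print) and is
NOT proved anywhere; T1 0∕1; nothing here bears on `IRcof`, `IR`, or the Yang–Mills mass gap (Clay: NOT proved); R4 = `BalabanLadder.UV` only.
-/

set_option autoImplicit false

noncomputable section

open Literature.MathematicalPhysics.QuantumFieldTheory

namespace Summit.QuantumFields.YangMills.Cruxes.IRcof.TwistedSlab

/-! ## §1 Real arithmetic: the exponential sandwich on one box -/

/-- **Purity from an EXPONENTIAL vacuum-dominance sandwich, one box and one period** (pure algebra): if the defect quantity obeys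
`1 − P₂/P² ≤ 1` (it does: `projSlabDefect_le_one`), `a² ≤ P₂`, `a ≤ P ≤ a·e^{x}` with `0 < a` and `0 ≤ x`, then `1 − P₂/P² ≤ 4x`
(for `x ≤ 1` via `defect_le_two_mul_of_sandwich` with `S = e^x − 1 ≤ 2x`; for `x > 1` trivially). [folklore] -/
theorem defect_le_four_mul_of_exp_sandwich {a P P₂ x : ℝ} (ha : 0 < a) (hx : 0 ≤ x) (hP₂ : a ^ 2 ≤ P₂)
    (hP : P ≤ a * Real.exp x) (haP : a ≤ P) (hle : 1 - P₂ / P ^ 2 ≤ 1) : 1 - P₂ / P ^ 2 ≤ 4 * x := by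
  rcases le_or_gt x 1 with hx1 | hx1
  · have hS : 0 ≤ Real.exp x - 1 := sub_nonneg.2 (Real.one_le_exp hx)
    have hP' : P ≤ a * (1 + (Real.exp x - 1)) := by rw [add_sub_cancel]; exact hP
    -- `e^x − 1 ≤ 2x` on `[0, 1]` (the tree's `SquarefreeSums.exp_sub_one_le_two_mul`, re-derived inline from `|e^x − 1 − x| ≤ x²`)
    have hexp : Real.exp x - 1 ≤ 2 * x := by
      have h := Real.abs_exp_sub_one_sub_id_le (show |x| ≤ 1 by rwa [abs_of_nonneg hx])
      have h2 : Real.exp x - 1 - x ≤ x ^ 2 := le_trans (le_abs_self _) h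
      have h3 : x ^ 2 ≤ x := by nlinarith
      linarith
    calc 1 - P₂ / P ^ 2 ≤ 2 * (Real.exp x - 1) := defect_le_two_mul_of_sandwich ha hS hP₂ hP' haP
      _ ≤ 2 * (2 * x) := mul_le_mul_of_nonneg_left hexp (by norm_num)
      _ = 4 * x := by ring
  · linarith

/-! ## §2 The corrected plug: UNIFORM exponential vacuum dominance of the `e₂ = 0` sector ⇒ T1 -/

/-- ★ **THE PLUG (corrected form): T1 from UNIFORM EXPONENTIAL vacuum dominance of the `e₂ = 0` sector.**  If, in the binders of T1, the
projected twisted femto slab satisfies `λ^t ≤ projSlabZ(t) ≤ λ^t·exp(C·L·e^{−ct})` for all `t ≥ 2`, with `(c, C)` chosen BEFORE `β ≥ β₀` and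
`L ≥ 2` (and `λ = λ(β, L) > 0` after) — the finite-`t` correction to the `e₂ = 0` pressure is exponentially small in `t` and at most linear in
`L` — then `TwistedSlabAnchor` holds (constant `max (4C) (e^c)`, same `ℓ₀, β₀, c`).  This is the shape a weak-coupling cluster expansion about
the isolated twist-eating vacuum would deliver; `projSlabZ_vacuumDominated_oneBox` has it on one box with box-dependent constants
(`1 + D·τ^M ≤ exp(D·τ^M)`).  Supersedes `twistedSlabAnchor_of_uniform_vacuumDominance`, whose `1 + C·L·e^{−ct}` hypothesis cannot hold
uniformly in `L`.  HONEST: an implication; its hypothesis is NOT proved anywhere (it is the open content of T1). [folklore] -/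
theorem twistedSlabAnchor_of_uniform_expVacuumDominance
    (h : ∀ (G : Type) [Group G] [TopologicalSpace G] [IsTopologicalGroup G] [CompactSpace G],
      IsCompactSimpleLieGroup G → SimplyConnectedSpace G →
      letI : MeasurableSpace G := borel G
      haveI : BorelSpace G := ⟨rfl⟩
      ∀ (z : G) (n : ℕ), z ∈ Subgroup.center G → z ≠ 1 → 0 < n → z ^ n = 1 → HasIsolatingTwist G z →
        ∀ r : LatticeRep G, ∃ (ℓ₀ : ℕ) (β₀ c C : ℝ), 2 ≤ ℓ₀ ∧ 0 < c ∧ 0 ≤ C ∧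
          ∀ β : ℝ, β₀ ≤ β → ∀ L : ℕ, 2 ≤ L → ∃ lam : ℝ, 0 < lam ∧ ∀ t : ℕ, 2 ≤ t →
            lam ^ t ≤ projSlabZ r.ρ β z n ℓ₀ L t ∧
            projSlabZ r.ρ β z n ℓ₀ L t ≤ lam ^ t * Real.exp (C * (L : ℝ) * Real.exp (-(c * (t : ℝ))))) :
    TwistedSlabAnchor := by
  intro G _ _ _ _ hG hsc
  letI : MeasurableSpace G := borel G
  haveI : BorelSpace G := ⟨rfl⟩
  intro z n hz hz1 hn hzn hiso r
  obtain ⟨ℓ₀, β₀, c, C, hℓ₀, hc, hC0, hunif⟩ := h G hG hsc z n hz hz1 hn hzn hiso r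
  refine ⟨ℓ₀, β₀, c, max (4 * C) (Real.exp c), hℓ₀, hc, fun β hβ L t hL ht => ?_⟩
  obtain ⟨lam, hlam, hsand⟩ := hunif β hβ L hL
  have hL1 : (1 : ℝ) ≤ L := by exact_mod_cast (show 1 ≤ L by omega)
  rcases Nat.lt_or_ge t 2 with ht2 | ht2
  · -- `t = 1`: defect `≤ 1 ≤ e^{c}·L·e^{−c}`
    obtain rfl : t = 1 := by omega
    calc projSlabDefect r.ρ β z n ℓ₀ L 1 ≤ 1 := projSlabDefect_le_one r.ρ β z n ℓ₀ L 1
      _ = Real.exp c * 1 * Real.exp (-(c * ((1 : ℕ) : ℝ))) := by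
          rw [mul_one, Nat.cast_one, mul_one, ← Real.exp_add, add_neg_cancel, Real.exp_zero]
      _ ≤ max (4 * C) (Real.exp c) * (L : ℝ) * Real.exp (-(c * ((1 : ℕ) : ℝ))) := by
          gcongr
          exact le_max_right _ _
  · obtain ⟨hlo, hhi⟩ := hsand t ht2
    obtain ⟨hlo2, -⟩ := hsand (2 * t) (by omega)
    have hP2 : (lam ^ t) ^ 2 ≤ projSlabZ r.ρ β z n ℓ₀ L (2 * t) := by rw [← pow_mul, mul_comm]; exact hlo2
    have hx : 0 ≤ C * (L : ℝ) * Real.exp (-(c * (t : ℝ))) := by positivity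
    have hdef : projSlabDefect r.ρ β z n ℓ₀ L t ≤ 4 * (C * (L : ℝ) * Real.exp (-(c * (t : ℝ)))) := by
      unfold projSlabDefect
      exact defect_le_four_mul_of_exp_sandwich (pow_pos hlam t) hx hP2 hhi hlo
        (projSlabDefect_le_one r.ρ β z n ℓ₀ L t)
    calc projSlabDefect r.ρ β z n ℓ₀ L t ≤ 4 * (C * (L : ℝ) * Real.exp (-(c * (t : ℝ)))) := hdef
      _ = (4 * C) * (L : ℝ) * Real.exp (-(c * (t : ℝ))) := by ring
      _ ≤ max (4 * C) (Real.exp c) * (L : ℝ) * Real.exp (-(c * (t : ℝ))) := by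
          gcongr
          exact le_max_left _ _

/-- **The one-box theorem fits the corrected shape**: on every box, `λ₀^{M+2} ≤ projSlabZ(M+2) ≤ λ₀^{M+2}·exp(D·τ^M)` (`β ≥ 0`, continuous
unitary `ρ`, central `z` with `z^(m+1) = 1`; `D ≥ 0`, `τ = tanh(3Nβ·ℓ·ℓ·L)` as in `projSlabZ_vacuumDominated_oneBox`, using `1 + y ≤ e^y`).
[folklore] -/
theorem projSlabZ_expVacuumDominated_oneBox {G : Type*} [Group G] [TopologicalSpace G] [IsTopologicalGroup G] [CompactSpace G]
    [MeasurableSpace G] [BorelSpace G] [SecondCountableTopology G] {N : ℕ} {ρ : G →* Matrix (Fin N) (Fin N) ℂ}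
    (hρ : Continuous ρ) (hρu : ∀ g, ρ g ∈ Matrix.unitaryGroup (Fin N) ℂ)
    {β : ℝ} (hβ : 0 ≤ β) {z : G} (hz : z ∈ Subgroup.center G) {m : ℕ} (hzn : z ^ (m + 1) = 1) (ℓ L : ℕ) :
    ∃ lam₀ D : ℝ, 0 < lam₀ ∧ 0 ≤ D ∧ ∀ M : ℕ,
      lam₀ ^ (M + 2) ≤ projSlabZ ρ β z (m + 1) ℓ L (M + 2) ∧
      projSlabZ ρ β z (m + 1) ℓ L (M + 2) ≤
        lam₀ ^ (M + 2) * Real.exp (D * Real.tanh (3 * N * β * ((ℓ : ℝ) * ℓ * L)) ^ M) := by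
  obtain ⟨lam₀, D, hlam₀, hD, h⟩ := projSlabZ_vacuumDominated_oneBox hρ hρu hβ hz hzn ℓ L
  refine ⟨lam₀, D, hlam₀, hD, fun M => ⟨(h M).1, le_trans (h M).2 ?_⟩⟩
  exact mul_le_mul_of_nonneg_left (by linarith [Real.add_one_le_exp (D * Real.tanh (3 * N * β * ((ℓ : ℝ) * ℓ * L)) ^ M)])
    (pow_nonneg hlam₀.le _)

end Summit.QuantumFields.YangMills.Cruxes.IRcof.TwistedSlab

end
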